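import Literature.NumberTheory.GelbartRogawski1991.UnitaryDualPairWeilCoinvariantsTwistVanishing
import HarnessLib

/-!
# Weil coinvariants of a non-smooth compatible pair splitting — the dichotomy through a continuous `ι : G →* U(J_V)(𝔸_{F,f})`

Topic `NumberTheory/GelbartRogawski1991`; namespace
`Literature.NumberTheory.GelbartRogawski1991.UnitaryDualPair.WeilCoinv`.  Kernel only (theorems; 0 definitions, 0 records,
0 named facts, no `sorry`).  Companion of `UnitaryDualPairWeilCoinvariantsTwistVanishing.lean`: the same statements
([GelbartRogawski1991, §3.1 Remark p. 457]: `s = s₀ ⊗ ĉ`; [BernsteinZelevinsky1976, §2.1]: twisted intertwiners between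
smooth modules vanish) with every `U(J_V)(𝔸_{F,f})`-smoothness clause PULLED BACK along a continuous homomorphism
`ι : G →* U(J_V)(𝔸_{F,f})` of topological groups — the shape in which a hermitian space acts on `Ω(s, χ)` through a frame
transport (at the pin of the HC_CM programme: `G = U(V)(𝔸_{L⁺,f})`, `ι = ιVE V`, and the Betti tower is a `G`-module).
Only continuity of `ι` is used (open subgroups pull back to open subgroups); no inverse of `ι` is needed.

* `finPairRepV_comp_twist_smooth`, `exists_isOpen_forall_twistCharV_comp_eq_one_of_smooth` — §1/§4 of the companion through `ι`;
* `linearMap_eq_zero_of_twistCharV_comp` — §2 through `ι`;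
* **`linearMap_eq_zero_of_not_smooth_comp`** — the dichotomy: for ANY compatible `s` of a datum with [GR91, Prop. 3.1.1], if
  `ω_f ∘ s_pair` is not smooth for the pair (`G` through `ι`, `U(J_W)(𝔸_{F,f})`), then every `ℂ`-linear `ψ : Ω(s, χ) → H`
  (`χ` with open kernel) with `ψ (Ω(s,χ)(ι g) x) = σ g (ψ x)` into a `G`-smooth `σ` is `0`;
* **`exists_eq_twist_openKer_of_smooth_comp`** — conversely a compatible `s` with smooth `ω_f ∘ s_pair` is `splittingOf hGR ⊗ ĉ`,
  `ĉ = 1` on `G₁(F)`, `ĉ_V ∘ ι` and `ĉ_W` trivial on open subgroups.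

## References
* [GelbartRogawski1991] S. Gelbart, J. Rogawski, *L-functions and Fourier–Jacobi coefficients for the unitary group
  U(3)*, Invent. Math. 105 (1991), §3.1 Prop. 3.1.1 p. 455 L1–3, Remark p. 457 L4–13.
* [BernsteinZelevinsky1976] I. N. Bernstein, A. V. Zelevinsky, *Representations of the group GL(n, F) where F is a
  non-archimedean local field*, Russian Math. Surveys 31:3 (1976), §2.1.
* [Liu2021] Y. Liu, *Fourier–Jacobi cycles and arithmetic relative trace formula*, Camb. J. Math. 9 (2021) =
  arXiv:2102.11518, Def. 4.11 (l. 2092–2096).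
-/

set_option autoImplicit false

noncomputable section

namespace Literature.NumberTheory.GelbartRogawski1991.UnitaryDualPair.WeilCoinv

open Literature.NumberTheory.GelbartRogawski1991 Literature.NumberTheory.GelbartRogawski1991.UnitaryDualPair
open Literature.NumberTheory.Automorphic Literature.NumberTheory.Weil1964
open Literature.RepresentationTheory
open scoped Kronecker
open NumberField

variable (F E : Type) [Field F] [NumberField F] [Field E] [NumberField E] [Algebra F E]
variable (c : E ≃ₐ[F] E) (N M : ℕ) {n : ℕ} (e : Fin N × Fin M ≃ Fin n)
variable (JV : Matrix (Fin N) (Fin N) E) (JW : Matrix (Fin M) (Fin M) E)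
variable {TV : Matrix (Fin N) (Fin N) F} {TW : Matrix (Fin M) (Fin M) F}
variable [Algebra.IsQuadraticExtension F E] {δ : E} (hcδ : c δ = -δ) (hδ : δ ≠ 0) {d : F}
  (hd : δ * δ = algebraMap F E d) (hV : TV.IsSymm) (hW : TW.IsSymm) (hVd : IsUnit TV.det) (hWd : IsUnit TW.det)
  (hJV : JV = TV.map (algebraMap F E)) (hJW : JW = TW.map (algebraMap F E))
  {s : UnitaryGroup.adelicPair F E c N M JV JW →* adelicMpCont F (Fin n) (adelicGram F e TV TW)}

section Comp

variable {G : Type*} [Group G] [TopologicalSpace G]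
  (ι : G →* UnitaryGroup.finAdelic F E c N JV) (hι : Continuous ι)
  (ĉ : UnitaryGroup.adelicPair F E c N M JV JW →* ℂˣ)
  (hs : (splittingDatum F E c N M e JV JW hcδ hδ hd hV hW hVd hWd hJV hJW).IsCompatible s)
  (hs' : (splittingDatum F E c N M e JV JW hcδ hδ hd hV hW hVd hWd hJV hJW).IsCompatible
    (adelicMpCont.twist F (Fin n) (adelicGram F e TV TW) s ĉ))

/-- §1 through `ι`: `G`-smoothness of `finPairRepV ∘ ι` passes along a twist with `ĉ_V ∘ ι` trivial on an open subgroup of `G`.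
[cite: GelbartRogawski1991, §3.1 Remark p. 457 L4–13] -/
theorem finPairRepV_comp_twist_smooth
    (hsm : ∀ v : FinSB F (Fin N × Fin M), ∃ K : Subgroup G, IsOpen (K : Set G) ∧
      ∀ g ∈ K, finPairRepV F E c N M e JV JW hcδ hδ hd hV hW hVd hWd hJV hJW hs (ι g) v = v)
    (hK : ∃ K : Subgroup G, IsOpen (K : Set G) ∧ ∀ g ∈ K, twistCharV F E c N M JV JW ĉ (ι g) = 1)
    (v : FinSB F (Fin N × Fin M)) :
    ∃ K : Subgroup G, IsOpen (K : Set G) ∧ ∀ g ∈ K, finPairRepV F E c N M e JV JW hcδ hδ hd hV hW hVd hWd hJV hJW hs' (ι g) v = v := by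
  obtain ⟨K₁, hK₁, h₁⟩ := hsm v
  obtain ⟨K₂, hK₂, h₂⟩ := hK
  refine ⟨K₁ ⊓ K₂, ?_, fun g hg => ?_⟩
  · rw [Subgroup.coe_inf]
    exact hK₁.inter hK₂
  · rw [finPairRepV_twist F E c N M e JV JW hcδ hδ hd hV hW hVd hWd hJV hJW ĉ hs hs' (ι g) v,
      h₂ g (Subgroup.mem_inf.1 hg).2, h₁ g (Subgroup.mem_inf.1 hg).1, Units.val_one, one_smul]

/-- §4 through `ι`: if `finPairRepV hs ∘ ι` and `finPairRepV hs' ∘ ι` are both `G`-smooth then `ĉ_V ∘ ι` is trivial on an open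
subgroup of `G`. [cite: GelbartRogawski1991, §3.1 Remark p. 457 L4–13] [cite: BernsteinZelevinsky1976, §2.1] -/
theorem exists_isOpen_forall_twistCharV_comp_eq_one_of_smooth
    (hsm : ∀ v : FinSB F (Fin N × Fin M), ∃ K : Subgroup G, IsOpen (K : Set G) ∧
      ∀ g ∈ K, finPairRepV F E c N M e JV JW hcδ hδ hd hV hW hVd hWd hJV hJW hs (ι g) v = v)
    (hsm' : ∀ v : FinSB F (Fin N × Fin M), ∃ K : Subgroup G, IsOpen (K : Set G) ∧
      ∀ g ∈ K, finPairRepV F E c N M e JV JW hcδ hδ hd hV hW hVd hWd hJV hJW hs' (ι g) v = v) :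
    ∃ K : Subgroup G, IsOpen (K : Set G) ∧ ∀ g ∈ K, twistCharV F E c N M JV JW ĉ (ι g) = 1 := by
  have hv₀ : cosetIndicatorSB F (Fin N × Fin M) 0 ⊤ ≠ 0 := fun h0 => by
    have h1 := cosetIndicatorSB_apply_self (F := F) (ι := Fin N × Fin M) 0 ⊤
    rw [h0] at h1
    exact one_ne_zero (h1.symm.trans rfl)
  obtain ⟨K₁, hK₁, h₁⟩ := hsm (cosetIndicatorSB F (Fin N × Fin M) 0 ⊤)
  obtain ⟨K₂, hK₂, h₂⟩ := hsm' (cosetIndicatorSB F (Fin N × Fin M) 0 ⊤)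
  refine ⟨K₁ ⊓ K₂, ?_, fun g hg => ?_⟩
  · rw [Subgroup.coe_inf]
    exact hK₁.inter hK₂
  · have h := h₂ g (Subgroup.mem_inf.1 hg).2
    rw [finPairRepV_twist F E c N M e JV JW hcδ hδ hd hV hW hVd hWd hJV hJW ĉ hs hs' (ι g), h₁ g (Subgroup.mem_inf.1 hg).1] at h
    rw [← one_smul ℂ (cosetIndicatorSB F (Fin N × Fin M) 0 ⊤)] at h
    rw [smul_smul, mul_one] at h
    exact Units.ext (smul_left_injective ℂ hv₀ h)

/-- §2 through `ι`: **a `U(J_V)`-twist whose pull-back `ĉ_V ∘ ι` moves every open subgroup of `G` kills every `G`-intertwiner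
`Ω(s ⊗ ĉ, ĉ_W·χ) → H` into a `G`-smooth `σ`** (`Ω(s, χ) ∘ ι` `G`-smooth).
[cite: GelbartRogawski1991, §3.1 Remark p. 457 L4–13] [cite: BernsteinZelevinsky1976, §2.1] -/
theorem linearMap_eq_zero_of_twistCharV_comp
    {χ χ' : UnitaryGroup.finAdelic F E c M JW →* ℂˣ} (hχ : ∀ u, χ' u = twistCharW F E c N M JV JW ĉ u * χ u)
    (hsmΩ : ∀ x : TwistedCoinv.Coinv (finPairRepW F E c N M e JV JW hcδ hδ hd hV hW hVd hWd hJV hJW hs) χ,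
      ∃ K : Subgroup G, IsOpen (K : Set G) ∧ ∀ g ∈ K, weilCoinv F E c N M e JV JW hcδ hδ hd hV hW hVd hWd hJV hJW χ hs (ι g) x = x)
    {H : Type*} [AddCommGroup H] [Module ℂ H] (σ : Representation ℂ G H)
    (hσ : ∀ y : H, ∃ K : Subgroup G, IsOpen (K : Set G) ∧ ∀ g ∈ K, σ g y = y)
    (hcV : ∀ K : Subgroup G, IsOpen (K : Set G) → ∃ g ∈ K, twistCharV F E c N M JV JW ĉ (ι g) ≠ 1)
    (ψ : TwistedCoinv.Coinv (finPairRepW F E c N M e JV JW hcδ hδ hd hV hW hVd hWd hJV hJW hs') χ' →ₗ[ℂ] H)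
    (hψ : ∀ (g : G) (x : TwistedCoinv.Coinv (finPairRepW F E c N M e JV JW hcδ hδ hd hV hW hVd hWd hJV hJW hs') χ'),
      ψ (weilCoinv F E c N M e JV JW hcδ hδ hd hV hW hVd hWd hJV hJW χ' hs' (ι g) x) = σ g (ψ x)) :
    ψ = 0 :=
  linearMap_eq_zero_of_twisted_equiv ((weilCoinv F E c N M e JV JW hcδ hδ hd hV hW hVd hWd hJV hJW χ' hs').comp ι) ((weilCoinv F E c N M e JV JW hcδ hδ hd hV hW hVd hWd hJV hJW χ hs).comp ι)
    (weilCoinvTwistEquiv F E c N M e JV JW hcδ hδ hd hV hW hVd hWd hJV hJW ĉ hs hs' hχ) (fun g => twistCharV F E c N M JV JW ĉ (ι g))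
    (fun g x => weilCoinvTwistEquiv_weilCoinv F E c N M e JV JW hcδ hδ hd hV hW hVd hWd hJV hJW ĉ hs hs' hχ (ι g) x) hsmΩ σ hσ hcV ψ hψ

end Comp

/-- §3 through `ι`: **the DICHOTOMY for an arbitrary compatible splitting, `G` acting through a continuous
`ι : G →* U(J_V)(𝔸_{F,f})`.**  If `ω_f ∘ s_pair` is NOT smooth for the pair `(G` through `ι`, `U(J_W)(𝔸_{F,f}))` — some
vector is moved under `finPairRepV hs ∘ ι` by every open subgroup of `G`, or under `finPairRepW hs` by every open subgroup of
`U(J_W)(𝔸_{F,f})` — then for every `χ` with open kernel and every `G`-smooth `σ`, every `ℂ`-linear `ψ : Ω(s, χ) → H` with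
`ψ (Ω(s, χ)(ι g) x) = σ g (ψ x)` is `0`.  (Proof as in `linearMap_eq_zero_of_not_smooth`, the `U(J_V)`-side smoothness of the
[GR91] splitting being pulled back along the continuous `ι`.)
[cite: GelbartRogawski1991, §3.1 Prop. 3.1.1 p. 455 L1–3, Remark p. 457 L4–13] [cite: BernsteinZelevinsky1976, §2.1] -/
theorem linearMap_eq_zero_of_not_smooth_comp {G : Type*} [Group G] [TopologicalSpace G]
    (ι : G →* UnitaryGroup.finAdelic F E c N JV) (hι : Continuous ι)
    (hGR : (splittingDatum F E c N M e JV JW hcδ hδ hd hV hW hVd hWd hJV hJW).CompatibleSplitting)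
    (hs : (splittingDatum F E c N M e JV JW hcδ hδ hd hV hW hVd hWd hJV hJW).IsCompatible s)
    (hns : ¬ ((∀ v : FinSB F (Fin N × Fin M), ∃ K : Subgroup G, IsOpen (K : Set G) ∧
                  ∀ g ∈ K, finPairRepV F E c N M e JV JW hcδ hδ hd hV hW hVd hWd hJV hJW hs (ι g) v = v) ∧
              ∀ v : FinSB F (Fin N × Fin M), ∃ K : Subgroup (UnitaryGroup.finAdelic F E c M JW),
                IsOpen (K : Set (UnitaryGroup.finAdelic F E c M JW)) ∧
                  ∀ u ∈ K, finPairRepW F E c N M e JV JW hcδ hδ hd hV hW hVd hWd hJV hJW hs u v = v))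
    {χ : UnitaryGroup.finAdelic F E c M JW →* ℂˣ}
    (hχ : IsOpen ((χ.ker : Subgroup (UnitaryGroup.finAdelic F E c M JW)) : Set (UnitaryGroup.finAdelic F E c M JW)))
    {H : Type*} [AddCommGroup H] [Module ℂ H] (σ : Representation ℂ G H)
    (hσ : ∀ y : H, ∃ K : Subgroup G, IsOpen (K : Set G) ∧ ∀ g ∈ K, σ g y = y)
    (ψ : TwistedCoinv.Coinv (finPairRepW F E c N M e JV JW hcδ hδ hd hV hW hVd hWd hJV hJW hs) χ →ₗ[ℂ] H)
    (hψ : ∀ (g : G) (x : TwistedCoinv.Coinv (finPairRepW F E c N M e JV JW hcδ hδ hd hV hW hVd hWd hJV hJW hs) χ),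
      ψ (weilCoinv F E c N M e JV JW hcδ hδ hd hV hW hVd hWd hJV hJW χ hs (ι g) x) = σ g (ψ x)) :
    ψ = 0 := by
  have hs₀ := splittingOf_isCompatible F E c N M e JV JW hcδ hδ hd hV hW hVd hWd hJV hJW hGR
  have hsc₀ := continuous_pairSplitting_splittingOf F E c N M e JV JW hcδ hδ hd hV hW hVd hWd hJV hJW hGR
  obtain ⟨ĉ, hĉ, -, -⟩ := exists_eq_twist_of_isCompatible F E c N M e JV JW hcδ hδ hd hV hW hVd hWd hJV hJW hs₀ hs
  subst hĉ
  -- smoothness of the [GR91] splitting, the `U(J_V)`-side pulled back along `ι`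
  have hsmV₀ : ∀ v : FinSB F (Fin N × Fin M), ∃ K : Subgroup G, IsOpen (K : Set G) ∧
      ∀ g ∈ K, finPairRepV F E c N M e JV JW hcδ hδ hd hV hW hVd hWd hJV hJW hs₀ (ι g) v = v := fun v => by
    obtain ⟨K, hK, -, h⟩ := exists_isOpen_isCompact_forall_finPairRepV_apply_eq_self F E c N M e JV JW hcδ hδ hd hV hW hVd hWd hJV hJW hsc₀ hs₀ v
    refine ⟨K.comap ι, ?_, fun g hg => h (ι g) (Subgroup.mem_comap.1 hg)⟩
    rw [Subgroup.coe_comap]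
    exact hK.preimage hι
  have hsmW₀ : ∀ v : FinSB F (Fin N × Fin M), ∃ K : Subgroup (UnitaryGroup.finAdelic F E c M JW),
      IsOpen (K : Set (UnitaryGroup.finAdelic F E c M JW)) ∧
        ∀ u ∈ K, finPairRepW F E c N M e JV JW hcδ hδ hd hV hW hVd hWd hJV hJW hs₀ u v = v := fun v => by
    obtain ⟨𝔪, h𝔪, h⟩ := finPairRepW_smooth F E c N M e JV JW hcδ hδ hd hV hW hVd hWd hJV hJW hsc₀ hs₀ v
    exact ⟨_, UnitaryGroup.isOpen_finCongruenceLevel F E c M JW h𝔪, h⟩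
  have hχ₀ : ∀ u, χ u = twistCharW F E c N M JV JW ĉ u * ((twistCharW F E c N M JV JW ĉ)⁻¹ * χ) u := fun u => by
    rw [MonoidHom.mul_apply, MonoidHom.inv_apply, mul_inv_cancel_left]
  have hsmΩ₀ : ∀ x : TwistedCoinv.Coinv (finPairRepW F E c N M e JV JW hcδ hδ hd hV hW hVd hWd hJV hJW hs₀) ((twistCharW F E c N M JV JW ĉ)⁻¹ * χ),
      ∃ K : Subgroup G, IsOpen (K : Set G) ∧
        ∀ g ∈ K, weilCoinv F E c N M e JV JW hcδ hδ hd hV hW hVd hWd hJV hJW ((twistCharW F E c N M JV JW ĉ)⁻¹ * χ) hs₀ (ι g) x = x := fun x =>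
    weilCoinv_comp_smooth F E c N M e JV JW hcδ hδ hd hV hW hVd hWd hJV hJW _ ι hι hsc₀ hs₀ x
  by_cases hcV : ∀ K : Subgroup G, IsOpen (K : Set G) → ∃ g ∈ K, twistCharV F E c N M JV JW ĉ (ι g) ≠ 1
  · exact linearMap_eq_zero_of_twistCharV_comp F E c N M e JV JW hcδ hδ hd hV hW hVd hWd hJV hJW ι ĉ hs₀ hs hχ₀ hsmΩ₀ σ hσ hcV ψ hψ
  · push Not at hcV
    have hsmV := finPairRepV_comp_twist_smooth F E c N M e JV JW hcδ hδ hd hV hW hVd hWd hJV hJW ι ĉ hs₀ hs hsmV₀ hcV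
    have hnW : ¬ ∀ v : FinSB F (Fin N × Fin M), ∃ K : Subgroup (UnitaryGroup.finAdelic F E c M JW),
        IsOpen (K : Set (UnitaryGroup.finAdelic F E c M JW)) ∧
          ∀ u ∈ K, finPairRepW F E c N M e JV JW hcδ hδ hd hV hW hVd hWd hJV hJW hs u v = v :=
      fun hW' => hns ⟨hsmV, hW'⟩
    by_cases hcW : ∀ K : Subgroup (UnitaryGroup.finAdelic F E c M JW),
        IsOpen (K : Set (UnitaryGroup.finAdelic F E c M JW)) → ∃ u ∈ K, ((twistCharW F E c N M JV JW ĉ)⁻¹ * χ) u ≠ 1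
    · haveI := subsingleton_coinv_twist F E c N M e JV JW hcδ hδ hd hV hW hVd hWd hJV hJW ĉ hs₀ hs hχ₀ hsmW₀ hcW
      exact LinearMap.ext fun x => by rw [Subsingleton.elim x 0, map_zero, LinearMap.zero_apply]
    · push Not at hcW
      obtain ⟨K, hK, h1⟩ := hcW
      refine absurd (finPairRepW_twist_smooth F E c N M e JV JW hcδ hδ hd hV hW hVd hWd hJV hJW ĉ hs₀ hs hsmW₀
        ⟨K ⊓ χ.ker, ?_, fun u hu => ?_⟩) hnW
      · rw [Subgroup.coe_inf]
        exact hK.inter hχ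
      · have hu₁ : ((twistCharW F E c N M JV JW ĉ)⁻¹ * χ) u = 1 := h1 u (Subgroup.mem_inf.1 hu).1
        have hu₂ : χ u = 1 := (MonoidHom.mem_ker).1 (Subgroup.mem_inf.1 hu).2
        have h := hχ₀ u
        rwa [hu₁, hu₂, mul_one, eq_comm] at h

/-- §4 through `ι`: **a compatible `s` with `ω_f ∘ s_pair` smooth for `(G` through `ι`, `U(J_W))` is `splittingOf hGR ⊗ ĉ` with
`ĉ = 1` on `G₁(F)`, `ĉ_V ∘ ι` trivial on an open subgroup of `G` and `ĉ_W` trivial on an open subgroup of `U(J_W)(𝔸_{F,f})`.**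
[cite: GelbartRogawski1991, §3.1 Prop. 3.1.1 p. 455 L1–3, Remark p. 457 L4–13] [cite: BernsteinZelevinsky1976, §2.1] -/
theorem exists_eq_twist_openKer_of_smooth_comp {G : Type*} [Group G] [TopologicalSpace G]
    (ι : G →* UnitaryGroup.finAdelic F E c N JV) (hι : Continuous ι)
    (hGR : (splittingDatum F E c N M e JV JW hcδ hδ hd hV hW hVd hWd hJV hJW).CompatibleSplitting)
    (hs : (splittingDatum F E c N M e JV JW hcδ hδ hd hV hW hVd hWd hJV hJW).IsCompatible s)
    (hsmV : ∀ v : FinSB F (Fin N × Fin M), ∃ K : Subgroup G, IsOpen (K : Set G) ∧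
      ∀ g ∈ K, finPairRepV F E c N M e JV JW hcδ hδ hd hV hW hVd hWd hJV hJW hs (ι g) v = v)
    (hsmW : ∀ v : FinSB F (Fin N × Fin M), ∃ K : Subgroup (UnitaryGroup.finAdelic F E c M JW),
      IsOpen (K : Set (UnitaryGroup.finAdelic F E c M JW)) ∧
        ∀ u ∈ K, finPairRepW F E c N M e JV JW hcδ hδ hd hV hW hVd hWd hJV hJW hs u v = v) :
    ∃ ĉ : UnitaryGroup.adelicPair F E c N M JV JW →* ℂˣ,
      s = adelicMpCont.twist F (Fin n) (adelicGram F e TV TW) (splittingOf F E c N M e JV JW hcδ hδ hd hV hW hVd hWd hJV hJW hGR) ĉ ∧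
        (∀ γ ∈ (splittingDatum F E c N M e JV JW hcδ hδ hd hV hW hVd hWd hJV hJW).ratPts, ĉ γ = 1) ∧
        (∃ K : Subgroup G, IsOpen (K : Set G) ∧ ∀ g ∈ K, twistCharV F E c N M JV JW ĉ (ι g) = 1) ∧
        ∃ K : Subgroup (UnitaryGroup.finAdelic F E c M JW), IsOpen (K : Set (UnitaryGroup.finAdelic F E c M JW)) ∧
          ∀ u ∈ K, twistCharW F E c N M JV JW ĉ u = 1 := by
  have hs₀ := splittingOf_isCompatible F E c N M e JV JW hcδ hδ hd hV hW hVd hWd hJV hJW hGR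
  have hsc₀ := continuous_pairSplitting_splittingOf F E c N M e JV JW hcδ hδ hd hV hW hVd hWd hJV hJW hGR
  obtain ⟨ĉ, hĉ, hrat, -⟩ := exists_eq_twist_of_isCompatible F E c N M e JV JW hcδ hδ hd hV hW hVd hWd hJV hJW hs₀ hs
  subst hĉ
  refine ⟨ĉ, rfl, hrat, ?_, ?_⟩
  · refine exists_isOpen_forall_twistCharV_comp_eq_one_of_smooth F E c N M e JV JW hcδ hδ hd hV hW hVd hWd hJV hJW ι ĉ hs₀ hs (fun v => ?_) hsmV
    obtain ⟨K, hK, -, h⟩ := exists_isOpen_isCompact_forall_finPairRepV_apply_eq_self F E c N M e JV JW hcδ hδ hd hV hW hVd hWd hJV hJW hsc₀ hs₀ v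
    refine ⟨K.comap ι, ?_, fun g hg => h (ι g) (Subgroup.mem_comap.1 hg)⟩
    rw [Subgroup.coe_comap]
    exact hK.preimage hι
  · refine exists_isOpen_forall_twistCharW_eq_one_of_smooth F E c N M e JV JW hcδ hδ hd hV hW hVd hWd hJV hJW ĉ hs₀ hs (fun v => ?_) hsmW
    obtain ⟨𝔪, h𝔪, h⟩ := finPairRepW_smooth F E c N M e JV JW hcδ hδ hd hV hW hVd hWd hJV hJW hsc₀ hs₀ v
    exact ⟨_, UnitaryGroup.isOpen_finCongruenceLevel F E c M JW h𝔪, h⟩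

end Literature.NumberTheory.GelbartRogawski1991.UnitaryDualPair.WeilCoinv

end
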